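import Mathlib
import HarnessLib
import HarnessLib.Audit
import Summits.AtomisticToContinuum.Statement
import Literature.MathematicalPhysics.QuantumManyBody.PeriodicBoseGas
import Summits.AtomisticToContinuum.BoseEinsteinCondensation.Theorems.BECSectorPoincareTwoScaleScatteringLengthFinite
import HarnessLib.Audit.Status.Attr

/-!
Route: BECParticleIncrement

DORMANT since 2026-08-22T07:16:46Z (reconciler: no traction for 5.2 d (last activity item-evidence-added at 2026-08-17T02:46:11Z); parked, not closed — `ledger route dormant route-AtomisticToContinuum-BECParticleIncrement --off` to reac) — unstaffed, not closed; items shared with open routes are served there. `ledger route dormant <id> --off` reactivates.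

# Route BECParticleIncrement — one particle at a time — BEC as a per-particle increment of λ_max in
the fixed Dirichlet box

It suffices to show the ONE-PARTICLE INCREMENT BOUND at fixed box (card one-particle-at-a-time, its
STEP in the weakest
sufficient, mode-free form; gen-2 of the retired route BECParticleInduction, now with a conforming
deciding theorem): for
every repulsive finite-range radial v there are ρ₁ > 0 and L₀ such that in every Dirichlet box Λ_L
with L ≥ L₀ and for every
particle number M with M + 1 ≤ ρ₁L³ the ground-state condensate number (`condensateNumber` = λ_max
of the one-particle
density matrix of the ground state, through near-minimisers) grows by at least 1/2 when ONE particle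
is added:
λ_max(γ_(M+1)) ≥ λ_max(γ_M) + 1/2. Telescoping from M = 0 (`TrialState 0 L` is inhabited by the
constant 1, so
condensateNumber v 0 L = 0 and the first increment reads 1/2 ≤ λ_max(γ₁)) INSIDE THE FINAL BOX L =
(N/ρ)^(1/3) gives
λ_max(γ_N) ≥ N/2 for all ρ < ρ₁ and all large N — the conjunct with c = 1/2, ρ₀ = ρ₁ (theorem
`closes`, sorry-free).
X is split at open by the healing-length/box ratio g = (M+1)a/L: the Gross–Pitaevskii window g ≤ g₀
(GPWindowIncrement,
rank 4, base of the induction) and the bulk regime g > g₀ (BootstrapStep, rank 2, conditional on the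
induction hypothesis
and on StaticResponseBound, rank 3).
Lean: `∀ v : ℝ → ENNReal,
Literature.MathematicalPhysics.QuantumManyBody.BoseGas.IsRepulsiveFiniteRange v → ∃ ρ₁ L₀ : ℝ, 0 <
ρ₁ ∧ ∀ L : ℝ, L₀ ≤ L → ∀ M : ℕ, (M : ℝ) + 1 ≤ ρ₁ * L ^ 3 →
Literature.MathematicalPhysics.QuantumManyBody.BoseGas.condensateNumber v M L + 2⁻¹ ≤
Literature.MathematicalPhysics.QuantumManyBody.BoseGas.condensateNumber v (M + 1) L`

## Assembly
Pure logic plus ENNReal/real arithmetic, all PROVED sorry-free in the planner's Sketch.lean: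
`stepInduction : StepInduction`
(regime split + strong induction, above), `closes (h : IncrementBound) : BoseEinsteinCondensation`
(= glue.lean; given
ρ₁, L₀ take ρ₀ := ρ₁, c := 1/2; for ρ < ρ₀ and N ≥ ⌈ρ·max(L₀,0)³⌉ + 1 one has L = (N/ρ)^(1/3) ≥ L₀
and L³ = N/ρ, so
M + 1 ≤ N ≤ ρ₁L³ for all M < N; induction on M gives ofReal(M/2) ≤ condensateNumber v M L, whence
ofReal(N/2) ≤ condensateNumber v N (sideLength ρ N)), and `assembly_holds : Assembly := fun hG hA hS
hB => closes
(stepInduction hG hA hS hB)`. `BoseEinsteinCondensation` is the sub-problem Statement decl by name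
(root abbrev of
Literature.MathematicalPhysics.QuantumManyBody.BoseGas.BoseEinsteinCondensation). The route is
decided by IncrementBound
alone (closes), or by the four hypotheses of Assembly.

Rationale: WHY THIS LINE. Every thermodynamic-limit attempt in print fights the vanishing gap of the big box
("depletion ≤ L² × excess energy":
LSSY2005 Thm 5.1, Fournais2020 Thm 1.2, BrenneckeEtAl2024 Thm 1, ChongLiangNam2026, Junge2026;
barrier
KineticGapLengthScales, a THEOREM for energy-window arguments by the Galilei boost of
KineticGapLengthScalesNarrow). This
line never places a state in an energy window: it climbs in PARTICLE NUMBER at fixed box, M = 0 → N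
= ρL³, and each rung
compares two true ground states differing by one particle — particle M+1 as an equal-mass,
equal-coupling impurity in the
bath Ψ_M (exact: γ_(M+1)/(M+1) is the tagged particle's reduced density matrix; the symmetric ground
state is the ground
state of the tagged sector by positivity). Gen-2 precision bookkeeping (new vs the card): by
particle symmetry the tagged
particle's occupation p of the bath's top mode equals every bath particle's, so the increment is p +
M(p − p_M) and the
load is the O(1)-ABSOLUTE bath back-reaction M(p_M − p) ≤ 1/2 − ε (in Bogoliubov theory (c/2)√(ρ_M
a³): the derivative
form of the Lee–Huang–Yang depletion, second order in the impurity–bath coupling and infrared-finite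
in d = 3 exactly when
S(k) ≲ |k|, divergent in d = 1), not the O(1)-precision polaron residue; hence the bath's STATIC
RESPONSE is carried as
its own crux (sum rules: Stringari1995, PitaevskiiStringari1991) and no Landau/phonon-linearity
hypothesis is made.
Imported areas: rigorous Bose-polaron/Fröhlich technology for one particle dressed by a condensate
(MysliwySeiringer2020,
LampartTriay2025, arXiv:2311.05361, arXiv:1909.02430) — there with BEC of a mean-field bath ASSUMED,
here the bath is
certified by the induction hypothesis; impurity-induced condensate deformation in physics
(doi:10.1103/physreva.71.023606,
GuentherEtAl2021: finite for the interacting bath, orthogonality catastrophe for the ideal one);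
Gross–Pitaevskii-regime
Bogoliubov theory with norm approximation of the ground state (BoccatoEtAl2019, BoccatoEtAl2019Acta,
NamEtAl2022,
BrenneckeSchleinSchraven2022) for the base regime. Versus the 22 open BEC routes (2026-08-15) and
the negatives index (one BEC entry,
BECSwapAffinity.SwapJensen, unrelated): it works in the audited DIRICHLET box directly (no
boundary-transfer crux), targets
λ_max mode-free, and replaces "depletion ≤ L² × excess energy" by "depletion is ½-Lipschitz in N".

RANKED CRUXES. #0 IncrementBound (target) — X — per-particle increment of the ground-state
condensate number in a fixed Dirichlet box throughout the dilute range: ∀ repulsive finite-range v ∃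
ρ₁ > 0, L₀ ∀ L ≥ L₀ ∀ M with M + 1 ≤ ρ₁L³: condensateNumber v M L + 1/2 ≤ condensateNumber v (M+1)
L. Sanity: v ≡ 0 gives increments exactly 1 (product ground state); M = 0 → 1 is 0 → 1; Bogoliubov:
dN₀/dN = 1 − (4/√π)√(ρa³) ≥ 1/2 iff ρa³ ≤ π/64. (why it might fail: ½-Lipschitz-in-N (derivative)
form of TL-BEC at EVERY M ≤ ρ₁L³, strictly stronger than the conjunct: it needs O(1)-absolute
control of λ_max across one added particle; a single jump > 1/2 (exotic admissible v, hard shells)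
refutes it while BEC survives.) [LSSY2005, BoccatoEtAl2019, Stringari1995, GuentherEtAl2021]
#2 BootstrapStep (crux) — the bulk-regime step as a ONE-IMPURITY problem with the bath certified
(card STEP): ∀ v ∀ C ∃ g₀, ρ₁ > 0, L₀ ∀ L ≥ L₀ ∀ M with g₀L < (M+1)a and M + 1 ≤ ρ₁L³: IF
λ_max(γ_M') ≥ M'/2 for all M' ≤ M and the increments hold for all M' < M (induction hypothesis) AND
the static-response inequality of StaticResponseBound with constant C holds at every M' ≤ M + 1 in
this box, THEN condensateNumber v M L + 1/2 ≤ condensateNumber v (M+1) L. Mechanism: H_(M+1) = H_M −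
Δ_y + Σ_j v(x_j − y); renormalise the impurity coupling by the scattering solution; tagged residue p
≥ 1 − C'√(ρ_M a³) − o(1) (one loop: Σ_k |ŵ_k|² ρ m₋₁(k)/(4k²L³) by the recoil inequality (ω + k²)² ≥
4ωk²) and bath back-reaction M(p_M − p) ≤ C''√(ρ_M a³) + o(1) (second-order response of the bath's
condensate to one renormalised impurity), both fed by the response hypothesis; g₀ large makes ξ_M/L
= (8πg_M)^(−1/2) small (bulk regime). [deps: StaticResponseBound] [difficulty: open-problem] (why it
might fail: The back-reaction needs O(1)-absolute control of the bath's condensate number under a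
local O(1) perturbation of H, knowing only λ_max ≥ M'/2 and m₋₁ of density modes; beyond second
order Gavoret–Nozières logs / 3-body recombination may enter; hypotheses may be too weak in kind.)
[MysliwySeiringer2020, LampartTriay2025, arXiv:2311.05361, arXiv:1909.02430, GuentherEtAl2021,
doi:10.1103/physreva.71.023606, GavoretNozieres1964, Stringari1995, BoccatoEtAl2019]
#3 StaticResponseBound (crux) — uniform static density-response (compressibility-type) bound for the
TRUE ground state at every particle number in the dilute fixed box, typed as a symmetric second
difference of cosine-sourced Dirichlet ground-state energies (concavity in t gives the other
inequality for free; t(1 ± cos) ≥ 0 keeps potentials in ℝ≥0∞): ∀ v ∃ C, ρ₁ > 0, L₀ ∀ L ≥ L₀ ∀ M ≤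
ρ₁L³ ∀ k ≠ 0 ∃ t₀ > 0 ∀ t ∈ (0, t₀]: 2E₀(M) + 2tM ≤ E₀(M; +t, k) + E₀(M; −t, k) + C t² M/(|k|² +
(M/L³)a). For fixed M, L (gap, unique ground state) this is m₋₁(Σ_j cos k·x_j) ≤ (C/2)·M/(k² + ρ_M
a), i.e. χ(k) ≲ min(1/(ρa), 1/k²); Bogoliubov value (ħ = 2m = 1) m₋₁ = (M/2)/(k² + 16πρa), so C = 1
at one loop; free gas: m₋₁ ≤ M/(2k²)-type, true; Dirichlet walls enter only through powers of
1/(kL). Shared in substance with card kv-insertion-corrector (K1, torus form). [difficulty: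
open-problem] (why it might fail: It is the INFINITESIMAL (m₋₁) static response of the TRUE ground
state, uniform in M ≤ ρ₁L³, L and k ≠ 0: energy localisation carries t-independent errors and never
reaches t → 0; it is a one-sided gap H − E₀ ≳ (k² + ρa)S(k) on ρ_kΨ₀; one soft density mode at some
M kills it.) [Stringari1995, PitaevskiiStringari1991, FournaisSolovej2020,
BrenneckeSchleinSchraven2022, BrenneckeEtAl2024, LSSY2005]
#4 GPWindowIncrement (crux) — the BASE REGIME — the increment in the Gross–Pitaevskii window of the
fixed Dirichlet cube: ∀ v with scatteringLength v ≠ ⊤ ∀ g₀ > 0 ∃ L₀ ∀ L ≥ L₀ ∀ M with (M+1)·a ≤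
g₀·L: condensateNumber v M L + 1/2 ≤ condensateNumber v (M+1) L (a = 0 is the free gas, increments
1). Here ρ_M ≤ g₀/(aL²) → 0 and ξ_M ≳ L: the only regime where complete BEC is a theorem
(LiebSeiringer2002, LSSY2005 Thms 5.1/7.1) and where a NORM approximation of the ground state exists
(BoccatoEtAl2019Acta on the torus; NamEtAl2022, BrenneckeSchleinSchraven2022 in traps), so that d_M
:= M − λ_max(γ_M) = d_Bog(g_M) + o(1) uniformly in g_M = Ma/L ≤ g₀ would give d_(M+1) − d_M = O(a/L)
+ o(1) ≤ 1/2. Load-bearing (induction base) and the cheapest place to test the per-step form.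
[difficulty: XL] (why it might fail: Needs depletion asymptotics with o(1) errors UNIFORM in g =
Ma/L ≤ g₀ in the DIRICHLET cube (boundary layer of width ~L/√g) and their M-differences at precision
1/2; print covers the torus and smooth traps only; few-body rungs M = O(1) need a separate
(perturbative) argument.) [LiebSeiringer2002, LSSY2005, BoccatoEtAl2019, BoccatoEtAl2019Acta,
NamEtAl2022, BrenneckeSchleinSchraven2022]
#9 ScatteringLengthFinite (support) — a repulsive finite-range radial potential has finite
scattering length (indeed a ≤ R₀): test the Lieb–Yngvason functional with φ = 1 − (smooth bump equal
to 1 on B(0, R₀ + 1/2)), for which v·φ² ≡ 0 and ∫|∇φ|² < ∞. Needed to invoke GPWindowIncrement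
inside StepInduction; recorded as "not proved here" in PeriodicBoseGas.lean. [difficulty:
provable-now] [LSSY2005]
#9 StepInduction (support) — the glue of the regime split — GPWindowIncrement →
(ScatteringLengthFinite, inlined verbatim because that shared item is rendered later in the file) →
StaticResponseBound → BootstrapStep → IncrementBound: take C from StaticResponseBound, (g₀, ρ₁ᵇ,
L₀ᵇ) from BootstrapStep at that C, L₀ᵍ from GPWindowIncrement at max(g₀, 1); set ρ₁ := min, L₀ :=
max(…, 1); strong induction on M in the box: case (M+1)a ≤ max(g₀,1)L by the GP window, otherwise
BootstrapStep with the induction hypothesis (increments below M, telescoped to λ_max ≥ M'/2) and the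
response hypothesis (M' ≤ M + 1 ≤ ρ₁L³). PROVED sorry-free in the planner's Sketch.lean (theorem
`stepInduction`, 45 lines; axioms propext/Classical.choice/Quot.sound) — provable now by
transcription. [difficulty: provable-now] [LSSY2005]

TWO-LAYER PLAN. Foreseen glued splits (none filed now; k ≤ 3, depth 1). BootstrapStep ⇐
TaggedResidue → BathBackReaction → BootstrapStep
(TaggedResidue: the tagged particle's weight outside the bath's near-top mode is ≤ C√(ρ_M a³) + o(1)
— one renormalised
impurity with recoil, first order closed by StaticResponseBound via the recoil inequality, higher
orders Fröhlich/Nelson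
type at coupling √(ρa³); BathBackReaction: the bath's condensate number drops by ≤ 1/2 − C√(ρ_M a³)
when the impurity is
added — THE load-bearing child, second-order response of N₀ to a local perturbation).
StaticResponseBound ⇐ LargeKResponse
(|k| ≳ ξ⁻¹: Neumann localisation to GP boxes + Bogoliubov with external potential,
BrenneckeSchleinSchraven2022) →
SmallKResponse (|k| ≲ ξ⁻¹: variational characterisation m₋₁ = sup_φ[2⟨φ, C̃_kΨ₀⟩ − ⟨φ,(H − E₀)φ⟩]
against an LDA
comparison, FournaisSolovej2020-type energy input) → StaticResponseBound. GPWindowIncrement ⇐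
FewBodyRungs (M ≤ M₀ fixed,
L → ∞: perturbative) → DirichletGPDepletion (M₀ < M ≤ g₀L/a: Dirichlet-cube norm approximation
uniform in g, after
BoccatoEtAl2019Acta/NamEtAl2022) → GPWindowIncrement.

KILL CRITERIA. (1) A refutation of IncrementBound closes the route (`close --reason
refuted:IncrementBound`) UNLESS the witness is an
isolated jump at one M with the block sums Σ_(M≤M'<M+K) increments ≥ K/2 intact — then the one
repair is a new item
IncrementBoundR in block (K-step) form with the same split, and a re-certified `closes`. (2) A
refutation of
GPWindowIncrement (base regime, richest technology) kills the ladder: close. (3) A refutation of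
StaticResponseBound by a
soft long-wavelength density mode forces a pivot to an explicit CONDITIONAL BRIDGE on a Landau-type
hypothesis
(ω_min(k) ≥ c|k|) or closes the route; a refutation only at |k| ≫ ξ⁻¹ is repaired by a new item with
min(1/(ρa), 1/k²)·log
slack (the dressing integrals tolerate it). (4) If a refuter exhibits, in a model where the
conclusion is checkable, baths
satisfying BootstrapStep's hypotheses with increment < 1/2, the decomposition (not X) is wrong:
resplit BootstrapStep with a
stronger carried hypothesis. (5) Mooted if any open BEC route proves the conjunct (close --reason
superseded).

NOT DECOMPOSED YET. Deliberately not filed at open: (i) the two-body renormalisation of the impurity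
coupling (scattering solution /
generalised Bogoliubov transform) inside BootstrapStep; (ii) the TaggedResidue/BathBackReaction
split of BootstrapStep,
the large-k/small-k split of StaticResponseBound and the few-body/GP split of GPWindowIncrement
(Two-layer plan) — filed
only after a crux moves; (iii) the fixed-(M, L) spectral package provers will want (compact
resolvent, uniqueness of the
Dirichlet ground state for v finite a.e. / connected hard-core domain, convergence of
near-minimisers, condensateNumber =
λ_max(γ_Ψ₀), condensateNumber v 0 L = 0, condensateNumber ≤ M) — `--supports` lemmas, never items;
(iv) constants: 1/2
is arbitrary (any fixed c ∈ (0,1) telescopes to BEC with constant c; the Bogoliubov-rate sibling 1 −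
C(√(ρ_M a³) + a/L)
and the block (K-step) form are the natural restatements), and the periodic-box twin of the ladder
(constant mode), which
this line avoids on purpose.

CHEAPEST FALSIFIER. For the line: exact diagonalisation / DMC of M = 2…8 soft-sphere bosons in a
Dirichlet cube at Ma/L ≈ 0.3–3 — is
λ_max(γ_(M+1)) − λ_max(γ_M) ≥ 0.9 and monotone in M? (kit compute not available to this seat; a
refuter with `kit compute`
should run it first — one increment < 1/2 at small M refutes GPWindowIncrement and the Target.) By
hand: v ≡ 0 ⇒
increments = 1; Bogoliubov dN₀/dN = 1 − (4/√π)√(ρa³) ≥ 1/2 iff ρa³ ≤ π/64 ≈ 0.049 (scale of ρ₁);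
m₋₁(Σcos k·x) =
(M/2)/(k² + 16πρa) ≤ (M/2)/(k² + ρa) (C = 1 at one loop); Dirichlet sanity of StaticResponseBound:
wall-induced coupling
of cos(k·x) to the lowest modes is O((kL)⁻²) in amplitude, negligible; for k ≲ π/L the fluctuating
part of Σcos k·x_j is
a quadrupole of size (kL)², response ≪ M/(ρa): passes. The surface-state check for the tagged
particle in the mean-field
wall well U = 8πaρ of width ξ: √U·ξ = 1 < π/2, no bound state (the GP profile is the zero-energy
ground state of its own
mean-field operator): passes.

NUMBERS. Units ħ = 2m = 1. Bogoliubov: depletion 1 − N₀/N = (8/(3√π))√(ρa³), so dN₀/dN = 1 −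
(4/√π)√(ρa³) and increment ≥ 1/2 ⟺
depletion fraction ≤ 1/3 at one loop; e(k) = √(k⁴ + 16πρa k²), S(k) = k²/e(k), m₋₁(ρ_k)/N = 1/(k² +
16πρa), ξ =
(8πρa)^(−1/2), ξ_M/L = (8πg_M)^(−1/2) with g_M = Ma/L; LHY e(ρ) = 4πρ²a(1 + (128/(15√π))√(ρa³))
(FournaisSolovej2020,
YauYin2009). Printed condensation scales: L ≲ C(ρa³)^(−δ)(ρa)^(−1/2) (Fournais2020 Thm 1.2), κ <
2/5…≈0.4 against κ = 2/3
(KineticGapLengthScalesNarrow record: AdhikariBrenneckeSchlein2020 1/43, BrenneckeEtAl2024 1/20,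
ChongLiangNam2026 2/7 − ε,
Junge2026). GP window covers M + 1 ≤ g₀L/a = g₀N^(1/3)/(ρ^(1/3)a) of the N rungs. Items at open: 7
(3 cruxes).

DEFINITION REQUESTS. None filed. A named `sourcedGroundStateEnergy v U N L := ⨅ Ψ : TrialState N L,
energy v Ψ + ∫⁻ X, (Σ_j U (X j))·‖Ψ X‖²`
(one-body source U : Space → ℝ≥0∞) in Literature/MathematicalPhysics/QuantumManyBody would shorten
StaticResponseBound and
BootstrapStep (now inlined) and let a grounder dedup StaticResponseBound against card
kv-insertion-corrector's K1 if that
card is routed; ScatteringLengthFinite belongs in PeriodicBoseGas.lean (LSSY App. C) once proved.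

Novelty: Searches (2026-08-15, this seat; local searchd rc 75, arXiv API 429): `lit search --source crossref
"impurity Bose-Einstein
condensate depletion orthogonality catastrophe residue"` (12: GuentherEtAl2021,
doi:10.1103/physreva.63.013609,
doi:10.26226/m.6275705966d5dcf63a311482 polaron-to-cluster, doi:10.1103/physrevb.72.024534 depletion
in Bose–Fermi
mixtures, …); `lit search --source crossref "static properties positive ions atomic Bose-Einstein
condensates excess number
of atoms impurity"` (doi:10.1103/physreva.71.023606 Massignan–Pethick–Smith,
doi:10.1103/physreva.71.033605); `lit search
--source zbmath "Bose polaron Bogoliubov Fröhlich ground state"` (1: arXiv:2411.11655), `…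
"condensate fraction monotone
particle number dilute Bose gas ground state"` (0); `lit galaxy search --star all "impurity in a
Bose-Einstein condensate"`
(8: pdf arXiv:1909.02430 renormalised Bogoliubov–Fröhlich, arXiv:2112.06976, arXiv:2107.06931;
panama 4 physics
monographs), `… "condensate depletion induced by an impurity"` (0), `… "bosonic orthogonality
catastrophe"` (0); `lit
frontier AtomisticToContinuum --since 2023` (30; BEC side: arXiv:2603.20776, arXiv:2510.20493,
arXiv:2605.06844 — all
energy-window / localisation); `lit bridges --cross any` (no polaron or induction bridge); plus the
card's five refuter
novelty audits (AUDIT-2/14/26/36/32-g2: arXiv/crossref/zbMATH probes, same verdict).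
Nearest prior art found: LampartTriay2025 (arXiv:2411.11655) and MysliwySeiringer2020
(arXiv:2003.12371)  [refs: 10.1103/physreva.63.013609, 10.26226/m.6275705966d5dcf63a311482, 10.1103/physrevb.72.024534, 10.1103/physreva.71.023606, 10.1103/physreva.71.033605, 2411.11655, 1909.02430, 2112.06976, 2107.06931, 2603.20776, 2510.20493, 2605.06844, 2003.12371, doi:10.1103/physreva.63.013609, doi:10.26226/m.6275705966d5dcf63a311482, doi:10.1103/physrevb.72.024534, doi:10.1103/physreva.71.023606, doi:10.1103/physre]

Barriers (technique_class: induction-on-N, impurity-dressing, sum-rules, lambda-max): - technique_class: induction-on-N, impurity-dressing, sum-rules, lambda-max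
- Literature.Barriers.AtomisticToContinuum.KineticGapLengthScales: evaded as a CLASS — no energy
window, no Poincaré/kinetic gap at any scale: every item is a λ_max-target on true ground states
(condensateNumber, δ → 0) and uses their minimality through sourced ground-state energies, which
KineticGapLengthScalesNarrow (Galilei-boost theorem for energy-window statements) does not bind;
honest: BootstrapStep's remainder may need (H_M − E_M)⁻¹ on the gapless range of the impurity
coupling — the bet is that only the small-k density sector matters, the recoil k² of the added
particle is the infrared mass, and second order (finite with m₋₁ alone in d = 3) dominates.
- Literature.Barriers.AtomisticToContinuum.EnergyAsymptoticsWithoutCondensation: respected — no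
inference from the VALUE of E₀ to two orders; energies enter only as a FAMILY of cosine-sourced
ground-state energies (StaticResponseBound), and the mechanism is d = 3-specific (∫d³k m₋₁/k² < ∞;
for the Lieb–Liniger witness of EnergyAsymptoticsWithoutCondensationNarrow the dressing and
back-reaction integrals ∫dk/k² diverge), exactly the infrared distinction an evading argument must
use.
- Literature.Barriers.AtomisticToContinuum.BogoliubovPerturbationInfrared: APPLIES to BootstrapStep
beyond second order (T = 0, d = 3 loop expansion of the bath is log-divergent termwise); evaded only
in part: one renormalised impurity with recoil and DENSITY coupling

History (route lifecycle, newest last):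
- 2026-08-16T03:43:53Z · AUTO-CRUX (backfill): IncrementBound — hypotheses of the deciding theorem that nothing in the route derives are cruxes (operator:999:586464)
- 2026-08-22T07:16:46Z · DORMANT — reconciler: no traction for 5.2 d (last activity item-evidence-added at 2026-08-17T02:46:11Z); parked, not closed — `ledger route dormant route-AtomisticToConti (operator:999:1268904)

sub-problem: BoseEinsteinCondensation · status: dormant · opened planner-plancard-AtomisticToContinuum-BoseEin-5a9da1a9-g2-0 2026-08-15T18:53:02Z · rev 2 · ledger route-AtomisticToContinuum-BECParticleIncrement
GENERATED by the gate from the ledger (D-0016/17). Provers cite these decls: `theorem foo : Summit.AtomisticToContinuum.BoseEinsteinCondensation.Theses.BECParticleIncrement.<Decl> := …` in Summits/AtomisticToContinuum/BoseEinsteinCondensation/Theorems/<Name>.lean.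
-/

namespace Summit.AtomisticToContinuum.BoseEinsteinCondensation.Theses.BECParticleIncrement

open scoped BigOperators Topology Manifold Classical MeasureTheory ProbabilityTheory Matrix InnerProductSpace ComplexConjugate ContinuousMap
open Filter Set Function TopologicalSpace MeasureTheory

attribute [summit_statement] _root_.BoseEinsteinCondensation

/-- item stmt-AtomisticToContinuum-12320 · crux (kind.auto-crux: conjecture-grade) · rank 0 · open · by planner
why it might fail: ½-Lipschitz-in-N (derivative) form of TL-BEC at EVERY M ≤ ρ₁L³, strictly stronger than the conjunct: it needs O(1)-absolute control of λ_max across one added particle; a single jump > 1/2 (exotic admissible v, hard shells) refutes it while BEC survives.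
sources: LSSY2005, BoccatoEtAl2019, Stringari1995, GuentherEtAl2021
[target] X — per-particle increment of the ground-state condensate number in a fixed Dirichlet box
throughout the dilute range: ∀ repulsive finite-range v ∃ ρ₁ > 0, L₀ ∀ L ≥ L₀ ∀ M with M + 1 ≤ ρ₁L³:
condensateNumber v M L + 1/2 ≤ condensateNumber v (M+1) L. Sanity: v ≡ 0 gives increments exactly 1
(product ground state); M = 0 → 1 is 0 → 1; Bogoliubov: dN₀/dN = 1 − (4/√π)√(ρa³) ≥ 1/2 iff ρa³ ≤
π/64. -/
@[route_item "route-AtomisticToContinuum-BECParticleIncrement", crux]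
def IncrementBound : Prop :=
  ∀ v : ℝ → ENNReal, Literature.MathematicalPhysics.QuantumManyBody.BoseGas.IsRepulsiveFiniteRange v → ∃ ρ₁ L₀ : ℝ, 0 < ρ₁ ∧ ∀ L : ℝ, L₀ ≤ L → ∀ M : ℕ, (M : ℝ) + 1 ≤ ρ₁ * L ^ 3 → Literature.MathematicalPhysics.QuantumManyBody.BoseGas.condensateNumber v M L + 2⁻¹ ≤ Literature.MathematicalPhysics.QuantumManyBody.BoseGas.condensateNumber v (M + 1) L

/-- item stmt-AtomisticToContinuum-12321 · crux · rank 2 · open · by planner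
why it might fail: The back-reaction needs O(1)-absolute control of the bath's condensate number under a local O(1) perturbation of H, knowing only λ_max ≥ M'/2 and m₋₁ of density modes; beyond second order Gavoret–Nozières logs / 3-body recombination may enter; hypotheses may be too weak in kind.
sources: MysliwySeiringer2020, LampartTriay2025, arXiv:2311.05361, arXiv:1909.02430, GuentherEtAl2021, doi:10.1103/physreva.71.023606
[crux] the bulk-regime step as a ONE-IMPURITY problem with the bath certified (card STEP): ∀ v ∀ C ∃
g₀, ρ₁ > 0, L₀ ∀ L ≥ L₀ ∀ M with g₀L < (M+1)a and M + 1 ≤ ρ₁L³: IF λ_max(γ_M') ≥ M'/2 for all M' ≤ M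
and the increments hold for all M' < M (induction hypothesis) AND the static-response inequality of
StaticResponseBound with constant C holds at every M' ≤ M + 1 in this box, THEN condensateNumber v M
L + 1/2 ≤ condensateNumber v (M+1) L. Mechanism: H_(M+1) = H_M − Δ_y + Σ_j v(x_j − y); renormalise
the impurity coupling by the scattering solution; tagged residue p ≥ 1 − C'√(ρ_M a³) − o(1) (one
loop: Σ_k |ŵ_k|² ρ m₋₁(k)/(4k²L³) by the recoil inequality (ω + k²)² ≥ 4ωk²) and bath back-reaction
M(p_M − p) ≤ C''√(ρ_M a³) + o(1) (second-order response of the bath's condensate to one renormalised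
impurity), both fed by the response hypothesis; g₀ large makes ξ_M/L = (8πg_M)^(−1/2) small (bulk
regime). [deps: StaticResponseBound] [difficulty: open-problem] -/
@[route_item "route-AtomisticToContinuum-BECParticleIncrement"]
def BootstrapStep : Prop :=
  ∀ v : ℝ → ENNReal, Literature.MathematicalPhysics.QuantumManyBody.BoseGas.IsRepulsiveFiniteRange v → ∀ C : ℝ, ∃ g₀ ρ₁ L₀ : ℝ, 0 < ρ₁ ∧ ∀ L : ℝ, L₀ ≤ L → ∀ M : ℕ, g₀ * L < ((M : ℝ) + 1) * (Literature.MathematicalPhysics.QuantumManyBody.BoseGas.scatteringLength v).toReal → (M : ℝ) + 1 ≤ ρ₁ * L ^ 3 → (∀ M' : ℕ, M' ≤ M → ENNReal.ofReal ((M' : ℝ) / 2) ≤ Literature.MathematicalPhysics.QuantumManyBody.BoseGas.condensateNumber v M' L) → (∀ M' : ℕ, M' < M → Literature.MathematicalPhysics.QuantumManyBody.BoseGas.condensateNumber v M' L + 2⁻¹ ≤ Literature.MathematicalPhysics.QuantumManyBody.BoseGas.condensateNumber v (M' + 1) L) → (∀ M' : ℕ, M' ≤ M + 1 → ∀ k :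 EuclideanSpace ℝ (Fin 3), k ≠ 0 → ∃ t₀ : ℝ, 0 < t₀ ∧ ∀ t : ℝ, 0 < t → t ≤ t₀ → 2 * Literature.MathematicalPhysics.QuantumManyBody.BoseGas.groundStateEnergy v M' L + ENNReal.ofReal (2 * t * (M' : ℝ)) ≤ (⨅ Ψ : Literature.MathematicalPhysics.QuantumManyBody.BoseGas.TrialState M' L, (Literature.MathematicalPhysics.QuantumManyBody.BoseGas.energy v Ψ + ∫⁻ X, (∑ j : Fin M', ENNReal.ofReal (t * (1 + Real.cos (∑ i : Fin 3, k i * X j i)))) * (‖Ψ.ψ X‖₊ : ENNReal) ^ 2)) + (⨅ Ψ : Literature.MathematicalPhysics.QuantumManyBody.BoseGas.TrialState M' L, (Literature.MathematicalPhysics.QuantumManyBody.BoseGas.energy v Ψ + ∫⁻ X, (∑ j : Fin M', ENNReal.ofReal (t * (1 - Real.cos (∑ i : Fin 3, k i * X j i)))) * (‖Ψ.ψ X‖₊ : ENNReal) ^ 2)) + ENNReal.ofReal (C * t ^ 2 * (M' : ℝ) / (‖k‖ ^ 2 + (M' : ℝ) / L ^ 3 * (Literature.MathematicalPhysics.QuantumManyBody.BoseGas.scatteringLength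 v).toReal))) → Literature.MathematicalPhysics.QuantumManyBody.BoseGas.condensateNumber v M L + 2⁻¹ ≤ Literature.MathematicalPhysics.QuantumManyBody.BoseGas.condensateNumber v (M + 1) L

/-- item stmt-AtomisticToContinuum-12322 · crux · rank 3 · open · by planner
why it might fail: It is the INFINITESIMAL (m₋₁) static response of the TRUE ground state, uniform in M ≤ ρ₁L³, L and k ≠ 0: energy localisation carries t-independent errors and never reaches t → 0; it is a one-sided gap H − E₀ ≳ (k² + ρa)S(k) on ρ_kΨ₀; one soft density mode at some M kills it.
sources: Stringari1995, PitaevskiiStringari1991, FournaisSolovej2020, BrenneckeSchleinSchraven2022, BrenneckeEtAl2024, LSSY2005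
[crux] uniform static density-response (compressibility-type) bound for the TRUE ground state at
every particle number in the dilute fixed box, typed as a symmetric second difference of
cosine-sourced Dirichlet ground-state energies (concavity in t gives the other inequality for free;
t(1 ± cos) ≥ 0 keeps potentials in ℝ≥0∞): ∀ v ∃ C, ρ₁ > 0, L₀ ∀ L ≥ L₀ ∀ M ≤ ρ₁L³ ∀ k ≠ 0 ∃ t₀ > 0 ∀
t ∈ (0, t₀]: 2E₀(M) + 2tM ≤ E₀(M; +t, k) + E₀(M; −t, k) + C t² M/(|k|² + (M/L³)a). For fixed M, L
(gap, unique ground state) this is m₋₁(Σ_j cos k·x_j) ≤ (C/2)·M/(k² + ρ_M a), i.e. χ(k) ≲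
min(1/(ρa), 1/k²); Bogoliubov value (ħ = 2m = 1) m₋₁ = (M/2)/(k² + 16πρa), so C = 1 at one loop;
free gas: m₋₁ ≤ M/(2k²)-type, true; Dirichlet walls enter only through powers of 1/(kL). Shared in
substance with card kv-insertion-corrector (K1, torus form). [difficulty: open-problem] -/
@[route_item "route-AtomisticToContinuum-BECParticleIncrement"]
def StaticResponseBound : Prop :=
  ∀ v : ℝ → ENNReal, Literature.MathematicalPhysics.QuantumManyBody.BoseGas.IsRepulsiveFiniteRange v → ∃ C ρ₁ L₀ : ℝ, 0 < ρ₁ ∧ ∀ L : ℝ, L₀ ≤ L → ∀ M : ℕ, (M : ℝ) ≤ ρ₁ * L ^ 3 → ∀ k : EuclideanSpace ℝ (Fin 3), k ≠ 0 → ∃ t₀ : ℝ, 0 < t₀ ∧ ∀ t : ℝ, 0 < t → t ≤ t₀ → 2 * Literature.MathematicalPhysics.QuantumManyBody.BoseGas.groundStateEnergy v M L + ENNReal.ofReal (2 * t * (M : ℝ)) ≤ (⨅ Ψ : Literature.MathematicalPhysics.QuantumManyBody.BoseGas.TrialState M L, (Literature.MathematicalPhysics.QuantumManyBody.BoseGas.energy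 v Ψ + ∫⁻ X, (∑ j : Fin M, ENNReal.ofReal (t * (1 + Real.cos (∑ i : Fin 3, k i * X j i)))) * (‖Ψ.ψ X‖₊ : ENNReal) ^ 2)) + (⨅ Ψ : Literature.MathematicalPhysics.QuantumManyBody.BoseGas.TrialState M L, (Literature.MathematicalPhysics.QuantumManyBody.BoseGas.energy v Ψ + ∫⁻ X, (∑ j : Fin M, ENNReal.ofReal (t * (1 - Real.cos (∑ i : Fin 3, k i * X j i)))) * (‖Ψ.ψ X‖₊ : ENNReal) ^ 2)) + ENNReal.ofReal (C * t ^ 2 * (M : ℝ) / (‖k‖ ^ 2 + (M : ℝ) / L ^ 3 * (Literature.MathematicalPhysics.QuantumManyBody.BoseGas.scatteringLength v).toReal))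

/-- item stmt-AtomisticToContinuum-12323 · crux · rank 4 · open · by planner
why it might fail: Needs depletion asymptotics with o(1) errors UNIFORM in g = Ma/L ≤ g₀ in the DIRICHLET cube (boundary layer of width ~L/√g) and their M-differences at precision 1/2; print covers the torus and smooth traps only; few-body rungs M = O(1) need a separate (perturbative) argument.
sources: LiebSeiringer2002, LSSY2005, BoccatoEtAl2019, BoccatoEtAl2019Acta, NamEtAl2022, BrenneckeSchleinSchraven2022
[crux] the BASE REGIME — the increment in the Gross–Pitaevskii window of the fixed Dirichlet cube: ∀
v with scatteringLength v ≠ ⊤ ∀ g₀ > 0 ∃ L₀ ∀ L ≥ L₀ ∀ M with (M+1)·a ≤ g₀·L: condensateNumber v M L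
+ 1/2 ≤ condensateNumber v (M+1) L (a = 0 is the free gas, increments 1). Here ρ_M ≤ g₀/(aL²) → 0
and ξ_M ≳ L: the only regime where complete BEC is a theorem (LiebSeiringer2002, LSSY2005 Thms
5.1/7.1) and where a NORM approximation of the ground state exists (BoccatoEtAl2019Acta on the
torus; NamEtAl2022, BrenneckeSchleinSchraven2022 in traps), so that d_M := M − λ_max(γ_M) =
d_Bog(g_M) + o(1) uniformly in g_M = Ma/L ≤ g₀ would give d_(M+1) − d_M = O(a/L) + o(1) ≤ 1/2.
Load-bearing (induction base) and the cheapest place to test the per-step form. [difficulty: XL] -/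
@[route_item "route-AtomisticToContinuum-BECParticleIncrement"]
def GPWindowIncrement : Prop :=
  ∀ v : ℝ → ENNReal, Literature.MathematicalPhysics.QuantumManyBody.BoseGas.IsRepulsiveFiniteRange v → Literature.MathematicalPhysics.QuantumManyBody.BoseGas.scatteringLength v ≠ ⊤ → ∀ g₀ : ℝ, 0 < g₀ → ∃ L₀ : ℝ, ∀ L : ℝ, L₀ ≤ L → ∀ M : ℕ, ((M : ℝ) + 1) * (Literature.MathematicalPhysics.QuantumManyBody.BoseGas.scatteringLength v).toReal ≤ g₀ * L → Literature.MathematicalPhysics.QuantumManyBody.BoseGas.condensateNumber v M L + 2⁻¹ ≤ Literature.MathematicalPhysics.QuantumManyBody.BoseGas.condensateNumber v (M + 1) L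

/-- item stmt-AtomisticToContinuum-12324 · support · rank 9 · closed · proved by Summit.AtomisticToContinuum.BoseEinsteinCondensation.Theorems.becParticleIncrement_stepInduction_proof @ b1634edc3df5 (prover) · by planner
sources: LSSY2005
[support] the glue of the regime split — GPWindowIncrement → (ScatteringLengthFinite, inlined
verbatim because that shared item is rendered later in the file) → StaticResponseBound →
BootstrapStep → IncrementBound: take C from StaticResponseBound, (g₀, ρ₁ᵇ, L₀ᵇ) from BootstrapStep
at that C, L₀ᵍ from GPWindowIncrement at max(g₀, 1); set ρ₁ := min, L₀ := max(…, 1); strong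
induction on M in the box: case (M+1)a ≤ max(g₀,1)L by the GP window, otherwise BootstrapStep with
the induction hypothesis (increments below M, telescoped to λ_max ≥ M'/2) and the response
hypothesis (M' ≤ M + 1 ≤ ρ₁L³). PROVED sorry-free in the planner's Sketch.lean (theorem
`stepInduction`, 45 lines; axioms propext/Classical.choice/Quot.sound) — provable now by
transcription. [difficulty: provable-now] -/
@[route_item "route-AtomisticToContinuum-BECParticleIncrement"]
def StepInduction : Prop :=
  GPWindowIncrement → (∀ v : ℝ → ENNReal, Literature.MathematicalPhysics.QuantumManyBody.BoseGas.IsRepulsiveFiniteRange v → Literature.MathematicalPhysics.QuantumManyBody.BoseGas.scatteringLength v ≠ ⊤) → StaticResponseBound → BootstrapStep → IncrementBound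

/-- item stmt-AtomisticToContinuum-9006 · support · rank 9 · closed · proved by Summit.AtomisticToContinuum.BoseEinsteinCondensation.Theorems.scatteringLengthFinite_proof @ 2b49af526fb0 (prover) · by planner
sources: LSSY2005
[support] (shared verbatim with route EqualScatteringTransfer, stmt-AtomisticToContinuum-0851)
finite range ⇒ scatteringLength v ≠ ⊤ (a ≤ R₀ + ε by the C¹ trial φ = 0 on B_{R₀}, = 1 off B_{R₀+ε};
hard cores included since ⊤·0 = 0). Discharges the `≠ ⊤` hypothesis of the cruxes in the glue.
[difficulty: provable-now] -/
@[route_item "route-AtomisticToContinuum-BECParticleIncrement"]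
def ScatteringLengthFinite : Prop :=
  ∀ v : ℝ → ENNReal, Literature.MathematicalPhysics.QuantumManyBody.BoseGas.IsRepulsiveFiniteRange v → Literature.MathematicalPhysics.QuantumManyBody.BoseGas.scatteringLength v ≠ ⊤

/-- `ScatteringLengthFinite` holds: proved by `Summit.AtomisticToContinuum.BoseEinsteinCondensation.Theorems.scatteringLengthFinite_proof` @ 2b49af526fb0. -/
theorem ScatteringLengthFinite_holds : ScatteringLengthFinite := _root_.Summit.AtomisticToContinuum.BoseEinsteinCondensation.Theorems.scatteringLengthFinite_proof

/-- item stmt-AtomisticToContinuum-12325 · assembly · rank 1 · closed · proved by Summit.AtomisticToContinuum.BoseEinsteinCondensation.Theorems.becParticleIncrement_assembly_proof (prover) · by planner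
sources: LSSY2005
[assembly] GPWindowIncrement → ScatteringLengthFinite → StaticResponseBound → BootstrapStep →
BoseEinsteinCondensation (proved in Sketch.lean as `assembly_holds`; provable now by transcription). -/
@[route_item "route-AtomisticToContinuum-BECParticleIncrement"]
def Assembly : Prop :=
  GPWindowIncrement → ScatteringLengthFinite → StaticResponseBound → BootstrapStep → BoseEinsteinCondensation

/-! D-0027 §2.1 — DECIDING THEOREM (planner-authored via `route open/edit --closes-file`; by planner-plancard-AtomisticToContinuum-BoseEin-5a9da1a9-g2-0 2026-08-15T18:53:03Z):
its hypotheses are this route's items and its conclusion the sub-problem Statement (glue_lint), and it elaborates with this file. -/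

@[closes "route-AtomisticToContinuum-BECParticleIncrement"] theorem closes (h : IncrementBound) : BoseEinsteinCondensation := by
  -- Telescoping the per-particle increment from M = 0 inside the final box L = (N/ρ)^(1/3).
  intro v hv
  obtain ⟨ρ₁, L₀, hρ₁, hinc⟩ := h v hv
  refine ⟨ρ₁, hρ₁, fun ρ hρ hρ₁' => ?_⟩
  refine ⟨2⁻¹, by norm_num, ?_⟩
  rw [Filter.eventually_atTop]
  refine ⟨⌈ρ * (max L₀ 0) ^ 3⌉₊ + 1, fun N hN => ?_⟩
  -- arithmetic of one half in ℝ≥0∞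
  have half : ∀ m : ℕ, ENNReal.ofReal (((m + 1 : ℕ) : ℝ) / 2) = ENNReal.ofReal ((m : ℝ) / 2) + 2⁻¹ := by
    intro m
    have h2 : (2⁻¹ : ENNReal) = ENNReal.ofReal ((1 : ℝ) / 2) := by
      rw [one_div, ENNReal.ofReal_inv_of_pos (by norm_num : (0 : ℝ) < 2), ENNReal.ofReal_ofNat]
    rw [h2, ← ENNReal.ofReal_add (by positivity) (by positivity)]
    congr 1
    push_cast
    ring
  set L : ℝ := Literature.MathematicalPhysics.QuantumManyBody.BoseGas.sideLength ρ N with hLdef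
  have hNρ : (0 : ℝ) ≤ N / ρ := div_nonneg N.cast_nonneg hρ.le
  have hL3 : L ^ 3 = N / ρ := by
    rw [hLdef, Literature.MathematicalPhysics.QuantumManyBody.BoseGas.sideLength, ← Real.rpow_natCast,
      ← Real.rpow_mul hNρ]
    norm_num
  have hLnn : 0 ≤ L := by
    rw [hLdef, Literature.MathematicalPhysics.QuantumManyBody.BoseGas.sideLength]
    exact Real.rpow_nonneg hNρ _
  -- the final box is large: L₀ ≤ L
  have hL₀ : L₀ ≤ L := by
    have hN' : ρ * (max L₀ 0) ^ 3 ≤ N := by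
      have h1 : ρ * (max L₀ 0) ^ 3 ≤ ⌈ρ * (max L₀ 0) ^ 3⌉₊ := Nat.le_ceil _
      have h2 : (⌈ρ * (max L₀ 0) ^ 3⌉₊ : ℝ) ≤ N := by
        exact_mod_cast (by omega : ⌈ρ * (max L₀ 0) ^ 3⌉₊ ≤ N)
      linarith
    have hcube : (max L₀ 0) ^ 3 ≤ L ^ 3 := by
      rw [hL3, le_div_iff₀ hρ]
      linarith [mul_comm ρ ((max L₀ 0) ^ 3)]
    have hmax : max L₀ 0 ≤ L := by
      by_contra hlt
      push Not at hlt
      have : L ^ 3 < (max L₀ 0) ^ 3 := pow_lt_pow_left₀ hlt hLnn (by norm_num : (3 : ℕ) ≠ 0)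
      linarith
    exact le_trans (le_max_left _ _) hmax
  -- every intermediate particle number M < N is in the dilute range of the final box (ρ < ρ₁)
  have hdens : ∀ M : ℕ, M < N → (M : ℝ) + 1 ≤ ρ₁ * L ^ 3 := by
    intro M hM
    have h1 : (M : ℝ) + 1 ≤ N := by exact_mod_cast hM
    have h2 : (N : ℝ) ≤ ρ₁ * L ^ 3 := by
      rw [hL3, mul_div_assoc', le_div_iff₀ hρ]
      have : (N : ℝ) * ρ ≤ (N : ℝ) * ρ₁ := mul_le_mul_of_nonneg_left hρ₁'.le N.cast_nonneg
      linarith [mul_comm ρ₁ (N : ℝ)]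
    linarith
  -- telescoping: M/2 ≤ λ_max(γ_M) for all M ≤ N in the box of side L (base M = 0 is 0 ≤ _)
  have tele : ∀ M : ℕ, M ≤ N → ENNReal.ofReal ((M : ℝ) / 2) ≤
      Literature.MathematicalPhysics.QuantumManyBody.BoseGas.condensateNumber v M L := by
    intro M
    induction M with
    | zero => intro _; simp
    | succ m ih =>
      intro hm
      calc ENNReal.ofReal (((m + 1 : ℕ) : ℝ) / 2)
          = ENNReal.ofReal ((m : ℝ) / 2) + 2⁻¹ := half m
        _ ≤ Literature.MathematicalPhysics.QuantumManyBody.BoseGas.condensateNumber v m L + 2⁻¹ :=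
            add_le_add (ih (Nat.le_of_succ_le hm)) le_rfl
        _ ≤ Literature.MathematicalPhysics.QuantumManyBody.BoseGas.condensateNumber v (m + 1) L :=
            hinc L hL₀ m (hdens m (Nat.lt_of_succ_le hm))
  have hc : (2⁻¹ : ℝ) * N = (N : ℝ) / 2 := by ring
  rw [hc]
  exact tele N le_rfl

end Summit.AtomisticToContinuum.BoseEinsteinCondensation.Theses.BECParticleIncrement
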